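import Summits.KontsevichZagierPeriods.KontsevichZagierPeriods.Theorems.LinRedNormalFormArrangementNormalFormStubRebaseSimpleZeroNestedJanus

/-!
# Stub `stub_rebaseSimpleZero`, part `rebaseSimpleZero_nested2` (crux `ArrangementNormalForm`,
line `janus-bands`, v6.2) — brick `NestedCone`

The CONE ESTIMATE at a pinch vertex of a nested pair over a one-dimensional base (`b = 0`):
if on a measurable set `W ⊂ ℝ³` both fibres stay in the cone `0 < |tₗ − t₀| < β |y − y₀|`
and `|f| ≤ K/|y − y₀|`, then `f` is absolutely integrable on `W` — domination by the product
`K β · |t₁ − t₀|^{-1/2} · |t₂ − t₀|^{-1/2}` of one-variable integrable functions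
(`RebaseNest.integrableOn_cone`). Consequence (`RebaseNest.pinchAbove`, registered on the
literal class text as `rebaseSimpleZero_nestedPinchAbove`): a nested pair `A < tᵢ < tⱼ < B` with
`y`-free letters over a base cell on which `t₀ ≤ A ≤ B ≤ t₀ + β |y − y₀|` (a pinch `A = B = t₀`
at the end `y₀` of the cell is allowed), whose base pole is simple and not closer to the cell
than `y₀` and whose fibre poles stay away from `[t₀, B]`, is good for `GG 0 2 2`: the box of
the sub-section Janus (`RebaseNest.subJanus`) converges by the cone estimate.

References: M. Kontsevich, D. Zagier, *Periods* (2001), §1.2.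
-/

noncomputable section

open Set MeasureTheory MvPolynomial
open Literature.NumberTheory.Transcendental Literature.ModelTheory.ExponentialFields

namespace Summit.KontsevichZagierPeriods.ArrangementNormalForm.JanusBands

namespace RebaseNest

open SeparatePos RebasePos

section Cone

/-- `x ↦ 1/√x` is integrable on `(0, S)`. [folklore] -/
theorem integrableOn_inv_sqrt (S : ℝ) : IntegrableOn (fun x : ℝ => (Real.sqrt x)⁻¹) (Ioo 0 S) := by
  rcases le_or_gt S 0 with hS | hS
  · rw [Ioo_eq_empty (not_lt.2 hS)]
    exact integrableOn_empty
  · refine ((intervalIntegral.integrableOn_Ioo_rpow_iff hS).2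
      (by norm_num : (-1 : ℝ) < -(1 / 2))).congr_fun (fun x hx => ?_) measurableSet_Ioo
    show x ^ (-(1 / 2 : ℝ)) = (Real.sqrt x)⁻¹
    rw [Real.rpow_neg hx.1.le, Real.sqrt_eq_rpow]

/-- The one-variable dominating factor `1/√|x|` on `0 < |x| < S`, extended by `0`. -/
theorem exists_dominator (S : ℝ) : ∃ F : ℝ → ℝ, Integrable F ∧
    ∀ x : ℝ, 0 < |x| → |x| < S → F x = (Real.sqrt |x|)⁻¹ := by
  set H : ℝ → ℝ := (Ioo 0 S).indicator fun x => (Real.sqrt x)⁻¹ with hH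
  have hHi : Integrable H := (integrable_indicator_iff measurableSet_Ioo).2 (integrableOn_inv_sqrt S)
  refine ⟨fun x => H x + H (0 - x), hHi.add (hHi.comp_sub_left 0), fun x hx hxS => ?_⟩
  rcases lt_or_gt_of_ne (abs_pos.1 hx) with h | h
  · rw [abs_of_neg h] at hxS ⊢
    simp [hH, indicator_of_notMem, indicator_of_mem, h.le, neg_pos.2 h, hxS]
  · rw [abs_of_pos h] at hxS ⊢
    simp [hH, indicator_of_notMem, indicator_of_mem, h, h.le, hxS]

/-- **Cone estimate** (dimension `3`, base coordinate `0`, fibres `1, 2`). If on a measurable set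
`W` both fibres satisfy `0 < |tₗ − t₀| < β |y − y₀|` with `|y − y₀| ≤ R`, and `|f| ≤ K/|y − y₀|`
on `W` with `f` a.e.-strongly measurable there, then `f` is integrable on `W`. [folklore] -/
theorem integrableOn_cone {f : (Fin 3 → ℝ) → ℝ} {W : Set (Fin 3 → ℝ)} (hWm : MeasurableSet W)
    (hf : AEStronglyMeasurable f (volume.restrict W)) {y₀ t₀ β K R : ℝ} (hβ : 0 < β)
    (hW : ∀ z ∈ W, |z 0 - y₀| ≤ R ∧ (0 < |z 1 - t₀| ∧ |z 1 - t₀| < β * |z 0 - y₀|) ∧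
      (0 < |z 2 - t₀| ∧ |z 2 - t₀| < β * |z 0 - y₀|))
    (hfK : ∀ z ∈ W, |f z| ≤ K / |z 0 - y₀|) : IntegrableOn f W := by
  obtain ⟨F, hFi, hF⟩ := exists_dominator (β * R)
  set G : Fin 3 → ℝ → ℝ :=
    ![(Icc (y₀ - R) (y₀ + R)).indicator fun _ => 1, fun t => F (t - t₀), fun t => F (t - t₀)] with hG
  have hGi : ∀ l, Integrable (G l) := by
    refine Fin.forall_fin_succ.2 ⟨?_, Fin.forall_fin_two.2 ⟨hFi.comp_sub_right t₀, hFi.comp_sub_right t₀⟩⟩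
    exact (integrableOn_const (s := Icc (y₀ - R) (y₀ + R)) (C := (1 : ℝ)) (μ := volume)
      (by rw [Real.volume_Icc]; exact ENNReal.ofReal_lt_top.ne)).integrable_indicator measurableSet_Icc
  have hprod : Integrable (fun z : Fin 3 → ℝ => |K| * β * ∏ l, G l (z l)) :=
    (Integrable.fintype_prod (μ := fun _ => volume) hGi).const_mul (|K| * β)
  refine Integrable.mono' hprod.integrableOn hf ((ae_restrict_iff' hWm).2 (Filter.Eventually.of_forall
    fun z hz => ?_))
  obtain ⟨hy, ⟨h1, h1'⟩, ⟨h2, h2'⟩⟩ := hW z hz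
  have hc : 0 < |z 0 - y₀| := (mul_pos_iff_of_pos_left hβ).1 (h1.trans h1')
  have hR : β * |z 0 - y₀| ≤ β * R := mul_le_mul_of_nonneg_left hy hβ.le
  have hIcc : z 0 ∈ Icc (y₀ - R) (y₀ + R) := by
    constructor <;> linarith [(abs_le.1 hy).1, (abs_le.1 hy).2]
  rw [Real.norm_eq_abs, Fin.prod_univ_three]
  simp only [hG, Matrix.cons_val_zero, Matrix.cons_val_one, Matrix.cons_val_two, Matrix.head_cons,
    Matrix.tail_cons, indicator_of_mem hIcc, hF _ h1 (h1'.trans_le hR), hF _ h2 (h2'.trans_le hR), one_mul]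
  -- `|f z| ≤ K/|y − y₀| ≤ |K| β /(√|t₁ − t₀| √|t₂ − t₀|)`
  have hsa := Real.sqrt_pos.2 h1
  have hsb := Real.sqrt_pos.2 h2
  have hab : Real.sqrt |z 1 - t₀| * Real.sqrt |z 2 - t₀| ≤ β * |z 0 - y₀| := by
    have h := mul_lt_mul'' (Real.sqrt_lt_sqrt (abs_nonneg _) h1') (Real.sqrt_lt_sqrt (abs_nonneg _) h2')
      (Real.sqrt_nonneg _) (Real.sqrt_nonneg _)
    rw [Real.mul_self_sqrt (by positivity)] at h
    exact h.le
  calc |f z| ≤ K / |z 0 - y₀| := hfK z hz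
    _ ≤ |K| / |z 0 - y₀| := div_le_div_of_nonneg_right (le_abs_self K) hc.le
    _ = |K| * (1 / |z 0 - y₀|) := by rw [mul_one_div]
    _ ≤ |K| * (β / (Real.sqrt |z 1 - t₀| * Real.sqrt |z 2 - t₀|)) := by
        refine mul_le_mul_of_nonneg_left ?_ (abs_nonneg K)
        rw [div_le_div_iff₀ hc (mul_pos hsa hsb), one_mul]
        exact hab
    _ = |K| * β * ((Real.sqrt |z 1 - t₀|)⁻¹ * (Real.sqrt |z 2 - t₀|)⁻¹) := by
        rw [mul_assoc, div_eq_mul_inv, mul_inv]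

end Cone

section PinchAbove

/-- Base coordinate of the literal text at `b = 0`, `k = 2`. -/
theorem castAdd_last_eq : (Fin.castAdd 2 (Fin.last 0) : Fin (0 + 1 + 2)) = (0 : Fin 3) := rfl

/-- First fibre coordinate of the literal text at `b = 0`, `k = 2`. -/
theorem natAdd_zero_eq : (Fin.natAdd (0 + 1) (0 : Fin 2) : Fin (0 + 1 + 2)) = (1 : Fin 3) := rfl

/-- Second fibre coordinate of the literal text at `b = 0`, `k = 2`. -/
theorem natAdd_one_eq : (Fin.natAdd (0 + 1) (1 : Fin 2) : Fin (0 + 1 + 2)) = (2 : Fin 3) := rfl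

/-- At `b = 0` an `x'`-affine form is its constant. -/
theorem affB_zero (c : (Fin 0 → ℚ) × ℚ) (z : Fin (0 + 1 + 2) → ℝ) : affB 0 2 c z = (c.2 : ℝ) := by
  simp [affB]

/-- The constant letter-parallel form `t₀` at `b = 0`. -/
theorem affF_const (t₀ : ℚ) (z : Fin (0 + 1 + 2) → ℝ) :
    affF 0 2 ((fun _ => (0 : ℚ)), t₀) z = (t₀ : ℝ) := by
  simp [affF]

variable {m m' : ℕ} {i j : Fin 2} (s : KZ.IntegralRep (0 + 1 + 2))
  (M : Fin m' → (Fin (0 + 1) → ℚ) × ℚ) (L : Fin m → (Fin 0 → ℚ) × ℚ) (e : Fin m → ℕ)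
  (p : MvPolynomial (Fin 0) ℚ) (ℓ₁ ℓ₂ : (Fin 0 → ℚ) × ℚ) (a : Fin 2 → Option ((Fin (0 + 1) → ℚ) × ℚ))
  (lo hi : Fin 2 → Fin 2 ⊕ ((Fin (0 + 1) → ℚ) × ℚ)) {n₁ n₂ : ℕ} (h1 : n₁ = 0) (hn : n₂ = 1)
  (hdom : s.domain = gDom 0 2 m' M lo hi) (hint : EqOn s.integrand (glit 0 2 p L e ℓ₁ ℓ₂ n₁ n₂ a) s.domain)
  (hij : i ≠ j) (A Bd : (Fin (0 + 1) → ℚ) × ℚ)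
  (hloi : lo i = Sum.inr A) (hhii : hi i = Sum.inl j) (hloj : lo j = Sum.inl i) (hhij : hi j = Sum.inr Bd)
  (ha0 : ∀ l c, a l = some c → c.1 (Fin.last 0) = 0) (y₀ t₀ β η R : ℚ) (hβ : 0 < β) (hη : 0 < η)
  (hI : ∀ z : Fin (0 + 1 + 2) → ℝ, (∀ r, 0 < affF 0 2 (M r) z) →
    0 < |z (Fin.castAdd 2 (Fin.last 0)) - y₀| ∧ |z (Fin.castAdd 2 (Fin.last 0)) - y₀| ≤ R)
  (hr : ∀ z : Fin (0 + 1 + 2) → ℝ, (∀ r, 0 < affF 0 2 (M r) z) →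
    |z (Fin.castAdd 2 (Fin.last 0)) - y₀| ≤ |z (Fin.castAdd 2 (Fin.last 0)) - ℓ₂.2|)
  (hTA : ∀ z : Fin (0 + 1 + 2) → ℝ, (∀ r, 0 < affF 0 2 (M r) z) → (t₀ : ℝ) ≤ affF 0 2 A z)
  (hAB : ∀ z : Fin (0 + 1 + 2) → ℝ, (∀ r, 0 < affF 0 2 (M r) z) → affF 0 2 A z ≤ affF 0 2 Bd z)
  (hcone : ∀ z : Fin (0 + 1 + 2) → ℝ, (∀ r, 0 < affF 0 2 (M r) z) →
    affF 0 2 Bd z ≤ t₀ + β * |z (Fin.castAdd 2 (Fin.last 0)) - y₀|)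
  (hfar : ∀ l c, a l = some c → ∀ z : Fin (0 + 1 + 2) → ℝ, (∀ r, 0 < affF 0 2 (M r) z) →
    ∀ t : ℝ, (t₀ : ℝ) < t → t < affF 0 2 Bd z → (η : ℝ) ≤ |t - affF 0 2 c z|)

include h1 hn hI hr hfar hη in
/-- The literal integrand on the box `{t₀ < tₗ < B}` is `O(1/|y − y₀|)`. -/
theorem abs_glit_le_box (z : Fin (0 + 1 + 2) → ℝ) (hz : ∀ r, 0 < affF 0 2 (M r) z)
    (ht : ∀ l : Fin 2, (t₀ : ℝ) < z (Fin.natAdd (0 + 1) l) ∧ z (Fin.natAdd (0 + 1) l) < affF 0 2 Bd z) :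
    |glit 0 2 p L e ℓ₁ ℓ₂ n₁ n₂ a z| ≤
      |((p.coeff 0 : ℚ) : ℝ) / ∏ j', ((L j').2 : ℝ) ^ e j'| * (1 + 1 / η) ^ 2 / |z (Fin.castAdd 2 (Fin.last 0)) - y₀| := by
  subst h1 hn
  have hy := hI z hz
  have hfac : ∀ l : Fin 2, |(a l).elim (1 : ℝ) (fun c => 1 / (z (Fin.natAdd (0 + 1) l) -
      (∑ i', (c.1 i' : ℝ) * z (Fin.castAdd 2 i') + (c.2 : ℝ))))| ≤ 1 + 1 / η := by
    intro l
    rcases h : a l with _ | c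
    · simp only [Option.elim_none, abs_one]
      have : (0 : ℝ) ≤ 1 / η := by positivity
      linarith
    · have hfl := hfar l c h z hz _ (ht l).1 (ht l).2
      simp only [Option.elim_some]
      rw [show (∑ i', (c.1 i' : ℝ) * z (Fin.castAdd 2 i') + (c.2 : ℝ)) = affF 0 2 c z from rfl, abs_div,
        abs_one]
      calc 1 / |z (Fin.natAdd (0 + 1) l) - affF 0 2 c z| ≤ 1 / (η : ℝ) :=
            one_div_le_one_div_of_le (by positivity) hfl
        _ ≤ 1 + 1 / η := by linarith
  have hfib : |fib 0 2 a z| ≤ (1 + 1 / η) ^ 2 := by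
    rw [fib, Finset.abs_prod, Fin.prod_univ_two, sq]
    exact mul_le_mul (hfac 0) (hfac 1) (abs_nonneg _) (by positivity)
  have hp : MvPolynomial.aeval (fun i : Fin 0 => z (Fin.castAdd 2 (Fin.castSucc i))) p = ((p.coeff 0 : ℚ) : ℝ) := by
    conv_lhs => rw [MvPolynomial.eq_C_of_isEmpty p]
    rw [MvPolynomial.aeval_C, eq_ratCast]
  rw [glit_eq, hp, pow_zero, pow_one]
  simp only [affB_zero, abs_mul, abs_div, abs_one]
  have hK : 0 ≤ |((p.coeff 0 : ℚ) : ℝ)| / |∏ j', ((L j').2 : ℝ) ^ e j'| := by positivity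
  have hyr : 1 / |z (Fin.castAdd 2 (Fin.last 0)) - (ℓ₂.2 : ℝ)| ≤ 1 / |z (Fin.castAdd 2 (Fin.last 0)) - y₀| :=
    one_div_le_one_div_of_le hy.1 (hr z hz)
  calc |((p.coeff 0 : ℚ) : ℝ)| / |∏ j', ((L j').2 : ℝ) ^ e j'| * (1 / |z (Fin.castAdd 2 (Fin.last 0)) - (ℓ₂.2 : ℝ)|) *
        |fib 0 2 a z| ≤ |((p.coeff 0 : ℚ) : ℝ)| / |∏ j', ((L j').2 : ℝ) ^ e j'| *
        (1 / |z (Fin.castAdd 2 (Fin.last 0)) - y₀|) * (1 + 1 / η) ^ 2 :=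
        mul_le_mul (mul_le_mul_of_nonneg_left hyr hK) hfib (abs_nonneg _) (by positivity)
    _ = _ := by ring

include h1 hn hdom hint hij hloi hhii hloj hhij ha0 hβ hη hI hr hTA hAB hcone hfar in
/-- **Pinch above** (`b = 0`): a nested pair `A < tᵢ < tⱼ < B` with `y`-free letters over a base
cell on which `t₀ ≤ A ≤ B ≤ t₀ + β |y − y₀|` and `0 < |y − y₀| ≤ R` (a pinch `A = B = t₀` at
the end `y₀` of the cell is allowed), whose simple base pole is not closer to the cell than `y₀`
and whose fibre poles keep the distance `η` from `(t₀, B)`, is good for `GG 0 2 2`: sub-section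
Janus at `T = t₀`, the box converging by the cone estimate.
[Kontsevich–Zagier 2001, §1.2, rules (1), (2)] -/
theorem pinchAbove : ∃ c ∈ AddSubgroup.closure (GGset 0 2 2), KZ.of s - c ∈ KZ.relations := by
  set T : (Fin (0 + 1) → ℚ) × ℚ := ((fun _ => 0), t₀) with hTdef
  have hTv : ∀ z, affF 0 2 T z = t₀ := affF_const t₀
  set Box := gDom 0 2 m' M (Function.update (Function.update lo i (Sum.inr T)) j (Sum.inr T))
    (Function.update (Function.update hi i (Sum.inr Bd)) j (Sum.inr Bd)) with hBox
  have hmem : ∀ z ∈ Box, (∀ r, 0 < affF 0 2 (M r) z) ∧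
      ∀ l : Fin 2, (t₀ : ℝ) < z (Fin.natAdd (0 + 1) l) ∧ z (Fin.natAdd (0 + 1) l) < affF 0 2 Bd z := by
    intro z hz
    obtain ⟨hrw, hi', hj'⟩ := (mem_box M hij lo hi T Bd T Bd z).1 hz
    rw [hTv] at hi' hj'
    exact ⟨hrw, (forall_fin_two_iff hij).2 ⟨hi', hj'⟩⟩
  -- the box is bounded
  have hbox : Bornology.IsBounded Box := by
    rw [isBounded_iff_forall_norm_le]
    refine ⟨|(y₀ : ℝ)| + |(R : ℝ)| + (|(t₀ : ℝ)| + β * |(R : ℝ)|), fun z hz => ?_⟩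
    obtain ⟨hrw, ht⟩ := hmem z hz
    obtain ⟨-, hy⟩ := hI z hrw
    have hc := hcone z hrw
    have hβ' : (0 : ℝ) ≤ β := by exact_mod_cast hβ.le
    have hC : 0 ≤ |(y₀ : ℝ)| + |(R : ℝ)| + (|(t₀ : ℝ)| + β * |(R : ℝ)|) := by positivity
    rw [pi_norm_le_iff_of_nonneg hC]
    refine Fin.addCases (fun k => ?_) (fun l => ?_)
    · rw [Fin.fin_one_eq_zero k, Real.norm_eq_abs]
      change |z (Fin.castAdd 2 (Fin.last 0))| ≤ _
      have h1 : |z (Fin.castAdd 2 (Fin.last 0))| ≤ |(y₀ : ℝ)| + |(R : ℝ)| := by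
        have := abs_sub_abs_le_abs_sub (z (Fin.castAdd 2 (Fin.last 0))) y₀
        linarith [le_abs_self (R : ℝ)]
      have h2 : (0 : ℝ) ≤ |(t₀ : ℝ)| + β * |(R : ℝ)| := by positivity
      linarith
    · rw [Real.norm_eq_abs, abs_le]
      obtain ⟨hl, hu⟩ := ht l
      have hβR : β * |z (Fin.castAdd 2 (Fin.last 0)) - (y₀ : ℝ)| ≤ β * |(R : ℝ)| :=
        mul_le_mul_of_nonneg_left (hy.trans (le_abs_self _)) hβ'
      have h0 : (0 : ℝ) ≤ |(y₀ : ℝ)| + |(R : ℝ)| := by positivity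
      constructor <;> linarith [neg_abs_le (t₀ : ℝ), le_abs_self (t₀ : ℝ)]
  -- the literal integrand converges absolutely on the box (cone estimate)
  have hWm : MeasurableSet Box := IsSemialgebraic.measurableSet_holds (isSemialgebraic_gDom _ _ _ _)
  have hW : IntegrableOn (glit 0 2 p L e ℓ₁ ℓ₂ n₁ n₂ a) Box := by
    refine integrableOn_cone (y₀ := y₀) (t₀ := t₀) (R := R)
      (K := |((p.coeff 0 : ℚ) : ℝ) / ∏ j', ((L j').2 : ℝ) ^ e j'| * (1 + 1 / η) ^ 2) hWm
      (KZ.aestronglyMeasurable_of_isSemialgebraicFunOn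
        (isSemialgebraicFunOn_glit (isSemialgebraic_gDom _ _ _ _) _ _ _ _ _ _ _ _) hWm)
      (by exact_mod_cast hβ : (0 : ℝ) < β) (fun z hz => ?_) (fun z hz => ?_)
    · obtain ⟨hrw, ht⟩ := hmem z hz
      obtain ⟨hy0, hy⟩ := hI z hrw
      have hc := hcone z hrw
      have key : ∀ l : Fin 2, 0 < |z (Fin.natAdd (0 + 1) l) - t₀| ∧
          |z (Fin.natAdd (0 + 1) l) - t₀| < β * |z (Fin.castAdd 2 (Fin.last 0)) - y₀| := fun l => by
        obtain ⟨hl, hu⟩ := ht l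
        rw [abs_of_pos (sub_pos.2 hl)]
        exact ⟨sub_pos.2 hl, by linarith⟩
      exact ⟨hy, key 0, key 1⟩
    · obtain ⟨hrw, ht⟩ := hmem z hz
      exact abs_glit_le_box M L e p ℓ₁ ℓ₂ a h1 hn Bd y₀ t₀ η R hη hI hr hfar z hrw ht
  -- sub-section Janus at `T = t₀`
  exact subJanus s M L e p ℓ₁ ℓ₂ a lo hi (Or.inl h1) hdom hint hij A Bd T 0 hloi hhii hloj hhij ha0 rfl
    (fun z hz => (hTv z).symm ▸ hTA z hz) hAB hW hbox

end PinchAbove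

end RebaseNest

/-- **Registered part of `stub_rebaseSimpleZero` / `rebaseSimpleZero_nested2` (line `janus-bands`,
v6.2): pinch above, `b = 0`.** For a literal `GG 0 σ 2` datum with simple base pole
(`n₁ = 0`, `n₂ = 1`), nested fibres `A < tᵢ < tⱼ < B` and `y`-free letters, over a base cell on
which `0 < |y − y₀| ≤ R`, the base pole is not closer than `y₀` (`hI`),
`t₀ ≤ A ≤ B ≤ t₀ + β |y − y₀|` (`hAB`; a pinch `A = B` at `y₀` is allowed) and the fibre poles
keep the distance `η` from `(t₀, B)` (`hfar`), the representation is congruent modulo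
`KZ.relations` to the subgroup generated by the literal class `GG 0 2 2` (`RebaseNest.pinchAbove`:
sub-section Janus at `t₀`, cone estimate). [Kontsevich–Zagier 2001, §1.2, rules (1), (2)] -/
theorem rebaseSimpleZero_nestedPinchAbove (m m' n₁ n₂ : ℕ) (s : KZ.IntegralRep (0 + 1 + 2)) (M : Fin m' → (Fin (0 + 1) → ℚ) × ℚ) (L : Fin m → (Fin 0 → ℚ) × ℚ) (e : Fin m → ℕ) (p : MvPolynomial (Fin 0) ℚ) (ℓ₁ ℓ₂ : (Fin 0 → ℚ) × ℚ) (a : Fin 2 → Option ((Fin (0 + 1) → ℚ) × ℚ)) (lo hi : Fin 2 → Fin 2 ⊕ ((Fin (0 + 1) → ℚ) × ℚ)) (h1 : n₁ = 0) (hn : n₂ = 1) (hdom : s.domain = {z | (∀ j, 0 < ∑ i, ((M j).1 i : ℝ) * z (Fin.castAdd 2 i) + ((M j).2 : ℝ)) ∧ ∀ i, Sum.elim (fun j => z (Fin.natAdd (0 + 1) j)) (fun c => ∑ i', (c.1 i' : ℝ) * z (Fin.castAdd 2 i') + (c.2 : ℝ)) (lo i) < z (Fin.natAdd (0 + 1)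 i) ∧ z (Fin.natAdd (0 + 1) i) < Sum.elim (fun j => z (Fin.natAdd (0 + 1) j)) (fun c => ∑ i', (c.1 i' : ℝ) * z (Fin.castAdd 2 i') + (c.2 : ℝ)) (hi i)}) (hint : EqOn s.integrand (fun z => MvPolynomial.aeval (fun i => z (Fin.castAdd 2 (Fin.castSucc i))) p / (∏ j, (∑ i, ((L j).1 i : ℝ) * z (Fin.castAdd 2 (Fin.castSucc i)) + ((L j).2 : ℝ)) ^ e j) * ((z (Fin.castAdd 2 (Fin.last 0)) - (∑ i, (ℓ₁.1 i : ℝ) * z (Fin.castAdd 2 (Fin.castSucc i)) + (ℓ₁.2 : ℝ))) ^ n₁ / (z (Fin.castAdd 2 (Fin.last 0)) - (∑ i, (ℓ₂.1 i : ℝ) * z (Fin.castAdd 2 (Fin.castSucc i)) + (ℓ₂.2 : ℝ))) ^ n₂) * ∏ i, (a i).elim 1 (fun c => 1 / (z (Fin.natAdd (0 + 1) i) - (∑ i', (c.1 i' : ℝ) * z (Fin.castAdd 2 i') + (c.2 : ℝ))))) s.domain) (i j : Fin 2) (hij : i ≠ j) (A V : (Fin (0 + 1) → ℚ) × ℚ)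 (hloi : lo i = Sum.inr A) (hhii : hi i = Sum.inl j) (hloj : lo j = Sum.inl i) (hhij : hi j = Sum.inr V) (ha0 : ∀ l c, a l = some c → c.1 (Fin.last 0) = 0) (y₀ t₀ β η R : ℚ) (hβ : 0 < β) (hη : 0 < η) (hI : ∀ z : Fin (0 + 1 + 2) → ℝ, (∀ r, 0 < ∑ i', ((M r).1 i' : ℝ) * z (Fin.castAdd 2 i') + ((M r).2 : ℝ)) → 0 < |z (Fin.castAdd 2 (Fin.last 0)) - y₀| ∧ |z (Fin.castAdd 2 (Fin.last 0)) - y₀| ≤ R ∧ |z (Fin.castAdd 2 (Fin.last 0)) - y₀| ≤ |z (Fin.castAdd 2 (Fin.last 0)) - ℓ₂.2|) (hA : ∀ z : Fin (0 + 1 + 2) → ℝ, (∀ r, 0 < ∑ i', ((M r).1 i' : ℝ) * z (Fin.castAdd 2 i') + ((M r).2 : ℝ)) → (t₀ : ℝ) ≤ (∑ i', (A.1 i' : ℝ) * z (Fin.castAdd 2 i') + (A.2 : ℝ)) ∧ (∑ i', (A.1 i' : ℝ) * z (Fin.castAdd 2 i') + (A.2 : ℝ)) ≤ (∑ i', (V.1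 i' : ℝ) * z (Fin.castAdd 2 i') + (V.2 : ℝ)) ∧ (∑ i', (V.1 i' : ℝ) * z (Fin.castAdd 2 i') + (V.2 : ℝ)) ≤ t₀ + β * |z (Fin.castAdd 2 (Fin.last 0)) - y₀|) (hf : ∀ l c, a l = some c → ∀ z : Fin (0 + 1 + 2) → ℝ, (∀ r, 0 < ∑ i', ((M r).1 i' : ℝ) * z (Fin.castAdd 2 i') + ((M r).2 : ℝ)) → ∀ t : ℝ, (t₀ : ℝ) < t → t < (∑ i', (V.1 i' : ℝ) * z (Fin.castAdd 2 i') + (V.2 : ℝ)) → (η : ℝ) ≤ |t - (∑ i', (c.1 i' : ℝ) * z (Fin.castAdd 2 i') + (c.2 : ℝ))|) : ∃ c ∈ AddSubgroup.closure {w : KZ.FormalRep | ∃ (m m' n₁ n₂ : ℕ) (s : KZ.IntegralRep (0 + 1 + 2)) (M : Fin m' → (Fin (0 + 1) → ℚ) × ℚ) (L : Fin m → (Fin 0 → ℚ) × ℚ) (e : Fin m → ℕ) (p : MvPolynomial (Fin 0) ℚ) (ℓ₁ ℓ₂ : (Fin 0 → ℚ) × ℚ) (a : Fin 2 → Option ((Fin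 (0 + 1) → ℚ) × ℚ)) (lo hi : Fin 2 → Fin 2 ⊕ ((Fin (0 + 1) → ℚ) × ℚ)), (n₁ = 0 ∨ n₂ = 0) ∧ (2 = 2 → (∀ i c, a i = some c → c.1 (Fin.last 0) = 0) ∧ (∀ i c, (lo i = Sum.inr c ∨ hi i = Sum.inr c) → (c.1 (Fin.last 0) = 0 ∨ c = (Pi.single (Fin.last 0) 1, 0)))) ∧ Bornology.IsBounded s.domain ∧ s.domain = {z | (∀ j, 0 < ∑ i, ((M j).1 i : ℝ) * z (Fin.castAdd 2 i) + ((M j).2 : ℝ)) ∧ ∀ i, Sum.elim (fun j => z (Fin.natAdd (0 + 1) j)) (fun c => ∑ i', (c.1 i' : ℝ) * z (Fin.castAdd 2 i') + (c.2 : ℝ)) (lo i) < z (Fin.natAdd (0 + 1) i) ∧ z (Fin.natAdd (0 + 1) i) < Sum.elim (fun j => z (Fin.natAdd (0 + 1) j)) (fun c => ∑ i', (c.1 i' : ℝ) * z (Fin.castAdd 2 i') + (c.2 : ℝ)) (hi i)} ∧ EqOn s.integrand (fun z => MvPolynomial.aeval (fun i => z (Fin.castAdd 2 (Fin.castSucc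 i))) p / (∏ j, (∑ i, ((L j).1 i : ℝ) * z (Fin.castAdd 2 (Fin.castSucc i)) + ((L j).2 : ℝ)) ^ e j) * ((z (Fin.castAdd 2 (Fin.last 0)) - (∑ i, (ℓ₁.1 i : ℝ) * z (Fin.castAdd 2 (Fin.castSucc i)) + (ℓ₁.2 : ℝ))) ^ n₁ / (z (Fin.castAdd 2 (Fin.last 0)) - (∑ i, (ℓ₂.1 i : ℝ) * z (Fin.castAdd 2 (Fin.castSucc i)) + (ℓ₂.2 : ℝ))) ^ n₂) * ∏ i, (a i).elim 1 (fun c => 1 / (z (Fin.natAdd (0 + 1) i) - (∑ i', (c.1 i' : ℝ) * z (Fin.castAdd 2 i') + (c.2 : ℝ))))) s.domain ∧ w = KZ.of s}, KZ.of s - c ∈ KZ.relations :=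
  RebaseNest.pinchAbove s M L e p ℓ₁ ℓ₂ a lo hi h1 hn hdom hint hij A V hloi hhii hloj hhij ha0 y₀ t₀ β η R hβ hη
    (fun z hz => ⟨(hI z hz).1, (hI z hz).2.1⟩) (fun z hz => (hI z hz).2.2) (fun z hz => (hA z hz).1)
    (fun z hz => (hA z hz).2.1) (fun z hz => (hA z hz).2.2) hf

end Summit.KontsevichZagierPeriods.ArrangementNormalForm.JanusBands
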